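import Summits.QuantumFields.YangMills.Theorems.BalabanUVNodesN21SelectedThresholds
import Summits.QuantumFields.BalabanUV.T4Continuum.Support.ShellMeasureRootCompositionHistories

/-!
# YM-DAG node N21 (= NE7c) — THE SELECTION ROAD ON HISTORY-INDEXED TERM FAMILIES: every (R) and [dict] binder of
# `BalabanUVNodesN21SelectedThresholds` (module 18b) PROVED for the cell's `ShellMeasureRootCompositionHistories` term-family type,
# the dominating laws INSTANTIATED as OLDER-MEASURABLE ENVELOPES of the partial laws (lens Card 8's «parent law»)

Track A of `YM-PLAN.md` (cell `pub-ymgap`, HUMAN RULING D-0062), node **N21**; R134 fan-out seat `pub-ymgap-dag-n21-d` (s2), generation 5, module 20.  THEOREMS ONLY: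
0 `def`, 0 `sorry`, standard axioms; COUNT-NEUTRAL; `--supports` the K3‴ item `SpineGivenEndpointR13` (stmt-QuantumFields-19912 — the ₁₃ re-key of K3′ 19908, dag-lead
KEY TABLE WORDS-133: my lineage's spine lane 19908 → 19912) as a helper.  `N`-free, NO Theses
import, NO `Node00.Record13` import.  Imports module 18b `BalabanUVNodesN21SelectedThresholds` (p485209: `exists_goodAssignment`, `levelLedger_of_goodAssignment`,
`levelConst_le`) and the `pub-balaban` leaf `T4Continuum.ShellMeasureRootCompositionHistories` (the HISTORY-INDEXED term-family type: `histWeight`, `histShell`,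
`histPiece`, `partialLaw` and their (R)∕push lemmas `histShell_nonneg`, `histShell_le_histWeight`, `histShell_le_sum_piece`, `sum_histPiece_le`).

THE POINT.  Module 18b (ROW A″ of `LENS-nearmiss.md` v4.0) proved (M1) AT SELECTED THRESHOLDS for ANY finite family of finite laws and delivered both runs'
`LevelLedger`s ∕ road I's `ShellWeightBound` at SHARP carriers, leaving as displayed inputs, besides NODE O's threshold-parametric term object: the (R) facts of
that object, the two PUSHES of every slot against an abstract OLDER-MEASURABLE dominating law `ν K a s` (losses `M₁`, `M₂`), and the side condition `hdep`.  Lens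
Card 8 («one shared multiplier per level against PARENT densities», `Sketch-nearmiss-g4.lean` §C, 0 tree hits before this file) names the intended instance of
those laws.  HERE the instance is typed in the cell's own currency for B14 (2.17)–(2.18)-TYPE term families (`ShellMeasureRootCompositionHistories`: terms =
HISTORIES `τ ∈ T K` with their own finite positive weights on the common space `Ω K`, live small regions `small K τ ⊆ C K`, live small-field indicator products,
pieces, and the `s`-small PARTIAL LAWS), now THRESHOLD-PARAMETRIC (weights `ν K a t τ` at every admissible assignment `a`, thresholds by level `a (lvl K s)`):
* the (R) facts `sh_nonneg ∕ sh_le ∕ cover` of 18b are the leaf's lemmas at every assignment (nothing to display);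
* the piece push `hpush` of 18b is the leaf's `sum_histPiece_le` (pieces ≤ the `s`-small partial law's mass of the run's OWN threshold shell, under a.e.
  closeness of the two runs' tested variables — N16's letter BY LEVEL) followed by ONE measure inequality, the **ENVELOPE** `partialLaw_s ≤ M₁ • law K a s`
  of the partial law by an older-measurable finite law (§1 `toReal_le_of_le_smul`; §1 `partialLaw_le_of_sum_histLaw_le`: it suffices that the SUM of ALL
  histories' laws is enveloped — the parent law of Card 8);
* the total push `htotal` stays as stated (global mass control `M₂·law(univ) ≤ Σ_τ A_τ`);
* (M1) is 18b's selection (`exists_goodAssignment`, run on the joint slot family of both runs indexed by `σ × Bool`), one admissible threshold per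
  (comparison, level) shared by both runs.
CONCLUSIONS: `levelLedger_histories_of_goodAssignment` (one run), `levelLedgers_histories_of_selectedThresholds` (both runs, ONE selected assignment),
`shellWeightBound_histories_of_selectedThresholds` (road I's `ShellWeightBound … (C·ϑ^K)` via n21-a's `n21_knit_levels_geometric`); the K5 stub `S_N21 SRec`
with the REDUCED binder list is the sequel module 20b `BalabanUVNodesN21SelectedThresholdsHistoriesReading`.

THE (K8-i) READ (lens kill-test, pages read this session; locators, not adjectives).  [Balaban1988Convergent] p. 257 (2.18): *"The density ρ_k(V_k) can be
represented as ρ_k(V_k) = Σ χ_k(Ω_k) T_k exp A_k(1∕g_k², U_k), where the summation is over the admissible sequences of domains"*, p. 257–258: T_k *"is a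
composition of integrations restricted to large field regions in successive scales, and multiplications by characteristic functions, δ-functions defining
renormalization transformations, and gauge fixing expressions"* — positivity-preserving operations applied to the exponential of a REAL action: every history
term is a NONNEGATIVE function, which is exactly the leaf's type (positive weights `ν_τ`, indicator products in `[0,1]`); [Balaban1989LargeFieldI] p. 193: *"All the
above transformations preserve the k-th density ρ_k, they change only the representation of this density"* (quoted in `T4IndicatorShell`'s header).  In that
reading the natural envelope of `Σ_τ histLaw_τ` at source `t` is `e^{l₀B} ×` the run's threshold-FREE positive law at `t = 0` (all histories re-summed), for
which `hdep` is VACUOUS (`law K a s` constant in `a`) and `M₁ = e^{l₀B}`, `M₂ = e^{−l₀B}` are the tilt losses — (PD) is then not an estimate but the SIGN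
STRUCTURE of (2.18).  This identification is LOCATED ((R)-species structure of NODE O's term object), NOT typed and NOT asserted here: below, the envelope, the
mass control and `hdep` are DISPLAYED binders.

HONEST FRAMING (binding).  DISPLAYED, not discharged: NODE O's threshold-parametric HISTORY FAMILY over the admissible box (spaces `Ω K`, weights
`ν^X K a t τ`, live small regions, tested variables — TYPE only, nothing of Bałaban's transcribed); the ENVELOPES `law^X K a s` with `hdep` and the losses
`M₁`∕`M₂` (E-class inputs in general; free in the (2.18) reading above); the a.e. CLOSENESS `|u^A_s − u^B_s| ≤ Δ_{lvl s}` under every history weight (N16 BY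
LEVEL, `Δ_j ≤ ρ_j(1 − κ_j)θ_j`); admissibility of the box for print's single-run bounds ((L1-step)∕U2); N20's live window∕count; N16's rate `ρ_j ≤ c₁ϑ^j`.
(M1) for print's FIXED printed thresholds is untouched (the thresholds are SELECTED inside admissible windows — road (δ)'s lever).  Nothing of Bałaban's is
asserted or instantiated; NE7c is NOT PRINTED and NOT PROVED; **N21 is NOT discharged**; typed 28∕28, discharged count untouched; one finite four-torus
programme at fixed `ε` — NOT ℝ⁴, NOT infinite volume, NOT OS, NOT a mass gap, NOT Clay.  No decl below carries a cite tag ([folklore] bookkeeping).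
-/

set_option autoImplicit false

noncomputable section

open scoped BigOperators ENNReal
open MeasureTheory Set

namespace Summit.QuantumFields.YangMills.Theorems.N21SelectedThresholdsHistories

open Literature.MathematicalPhysics.QuantumFieldTheory.Balaban1983to89
open Literature.MathematicalPhysics.QuantumFieldTheory.Balaban1983to89.T4ShellMeasure (SlotAntiConcentration)
open T4IndicatorShell (ShellWeightBound)
open T4ShellMeasureLevels (LevelLedger LiveWindow)
open Summit.QuantumFields.BalabanUV.T4Continuum.ShellMeasureRootCompositionHistories
  (histWeight histShell histPiece histLaw partialLaw histShell_nonneg histShell_le_histWeight histShell_le_sum_piece sum_histPiece_le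
    isFiniteMeasure_histLaw)
open YMDAG.UVSplit (SpineCarriers SpineRecordPred S_N21)
open N21SelectedThresholds (exists_goodAssignment levelLedger_of_goodAssignment levelConst_le)

/-! ## §1 Envelopes: a partial law dominated by `M₁ ×` a finite law -/

section Envelope

variable {Ω : Type*} [MeasurableSpace Ω]

/-- a law dominated by `M₁ ×` a finite law (`μ ≤ M₁ • ν` as measures, `M₁ ≥ 0`) has every real mass dominated the same way:
`(μ E).toReal ≤ M₁ · (ν E).toReal`. [folklore] -/
theorem toReal_le_of_le_smul {μ ν : Measure Ω} [IsFiniteMeasure ν] {M : ℝ} (hM : 0 ≤ M)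
    (h : μ ≤ ENNReal.ofReal M • ν) (E : Set Ω) : (μ E).toReal ≤ M * (ν E).toReal := by
  have h1 : μ E ≤ ENNReal.ofReal M * ν E := by
    have := Measure.le_iff'.1 h E
    rwa [Measure.smul_apply, smul_eq_mul] at this
  have h2 : ENNReal.ofReal M * ν E ≠ ⊤ := ENNReal.mul_ne_top ENNReal.ofReal_ne_top (measure_ne_top ν E)
  have := ENNReal.toReal_mono h2 h1
  rwa [ENNReal.toReal_mul, ENNReal.toReal_ofReal hM] at this

variable {σ ι : Type*} [DecidableEq σ]

/-- **THE PARENT LAW ENVELOPES EVERY PARTIAL LAW**: the `s`-small partial law is a sub-sum of the histories' laws, so ONE envelope of the SUM of all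
histories' laws — `Σ_{τ ∈ T} histLaw_τ ≤ M₁ • law` (lens Card 8: the parent law of the step, older-measurable; in the (2.18) reading the run's
threshold-free positive law) — envelopes the partial law of EVERY slot at once. [folklore] -/
theorem partialLaw_le_of_sum_histLaw_le (T : Finset ι) (ν : ι → Measure Ω) (small : ι → Finset σ) (u : σ → Ω → ℝ)
    (ϑ : σ → ℝ) {law : Measure Ω} {M : ℝ≥0∞} (h : ∑ τ ∈ T, histLaw (ν τ) (small τ) u ϑ ≤ M • law) (s : σ) :
    partialLaw T ν small u ϑ s ≤ M • law := by
  refine le_trans ?_ h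
  unfold partialLaw
  exact Finset.sum_le_sum_of_subset_of_nonneg (Finset.filter_subset _ _) fun _ _ _ => Measure.zero_le _

end Envelope

/-! ## §2 ONE RUN: the level ledger of a threshold-parametric history family at a good assignment — (R) and the piece push PROVED -/

section OneRun

variable {Ω : ℕ → Type*} [∀ K, MeasurableSpace (Ω K)] {σ ι : Type*} [DecidableEq σ]
  {T : ℕ → Finset ι} {C : ℕ → Finset σ} {small : ℕ → ι → Finset σ} {lvl : ℕ → σ → ℕ}
  {ν : ∀ K : ℕ, (ℕ → ℝ) → ℝ → ι → Measure (Ω K)} [∀ K a t τ, IsFiniteMeasure (ν K a t τ)]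
  {law : ∀ K : ℕ, (ℕ → ℝ) → σ → Measure (Ω K)} [∀ K a s, IsFiniteMeasure (law K a s)]
  {u v : ∀ K : ℕ, σ → Ω K → ℝ} {ρ D' : ℕ → ℝ} {l₀ M₁ M₂ : ℝ}

/-- **ONE RUN: road I's `LevelLedger` for a HISTORY-INDEXED, THRESHOLD-PARAMETRIC term family READ AT an assignment `a K` per comparison.**  DATA on the
common spaces `Ω K`: histories `τ ∈ T K` with finite weights `ν K a t τ` (assignment `a`, source `t`), live small regions `small K τ ⊆ C K` (the live
slots, levels `lvl K s`), the run's OWN measurable tested variables `u K s` and the OTHER run's `v K s` (both `t`-free); thresholds by level `a K (lvl K s)`;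
per slot an older-measurable finite ENVELOPE law `law K a s`.  The run's letters are the leaf's: weights `histWeight`, shell parts `histShell` (design (i):
the live small slots refined against the other run), pieces `histPiece`.  HYPOTHESES at the assignment: the selection certificate `hgood` ((M1) for
`(law, u)` at the slot's level threshold, width `ρ_{lvl}`, constant `D′_{lvl}` — module 18b's `exists_goodAssignment`); a.e. CLOSENESS
`|u_s − v_s| ≤ ρ_{lvl s}·a K (lvl s)` under every weight in whose history `s` is live-small (N16 BY LEVEL); the ENVELOPE `partialLaw_s ≤ M₁ • law K (a K) s`;
the total mass control `M₂·law(univ) ≤ Σ_τ A_τ`.  CONCLUSION: `LevelLedger l₀ T A sh C piece lvl (j ↦ (M₁∕M₂)·D′ j) ρ` for the history letters at `a` —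
the three (R) fields are the leaf's `histShell_nonneg ∕ histShell_le_histWeight ∕ histShell_le_sum_piece`, the piece push is `sum_histPiece_le` + the
envelope, the slot field is 18b's `levelLedger_of_goodAssignment`.  NO (M1) binder, NO (R) binder, NO piece-push binder. [folklore] -/
theorem levelLedger_histories_of_goodAssignment (a : ℕ → ℕ → ℝ)
    (hu : ∀ K s, Measurable (u K s)) (hv : ∀ K s, Measurable (v K s))
    (hsmall : ∀ K, ∀ τ ∈ T K, small K τ ⊆ C K)
    (hgood : ∀ K, ∀ s ∈ C K, SlotAntiConcentration (law K (a K) s) (u K s) (a K (lvl K s)) (ρ (lvl K s)) (D' (lvl K s)))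
    (hD' : ∀ j, 0 ≤ D' j) (hρ0 : ∀ j, 0 ≤ ρ j) (hM₁ : 0 ≤ M₁) (hM₂ : 0 < M₂)
    (hclose : ∀ K t, |t| ≤ l₀ → ∀ τ ∈ T K, ∀ s ∈ small K τ,
      ∀ᵐ ω ∂(ν K (a K) t τ), |u K s ω - v K s ω| ≤ ρ (lvl K s) * a K (lvl K s))
    (henv : ∀ K t, |t| ≤ l₀ → ∀ s ∈ C K,
      partialLaw (T K) (ν K (a K) t) (small K) (u K) (fun s => a K (lvl K s)) s ≤ ENNReal.ofReal M₁ • law K (a K) s)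
    (hmass : ∀ K t, |t| ≤ l₀ → ∀ s ∈ C K, M₂ * (law K (a K) s univ).toReal ≤
      ∑ τ ∈ T K, histWeight (ν K (a K) t τ) (small K τ) (u K) (fun s => a K (lvl K s))) :
    LevelLedger l₀ T (fun K t τ => histWeight (ν K (a K) t τ) (small K τ) (u K) (fun s => a K (lvl K s)))
      (fun K t τ => histShell (ν K (a K) t τ) (small K τ) (u K) (v K) (fun s => a K (lvl K s))) C
      (fun K t s τ => histPiece (ν K (a K) t τ) (small K τ) (u K) (v K) (fun s => a K (lvl K s)) s) lvl
      (fun j => M₁ / M₂ * D' j) ρ := by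
  -- the piece push: the leaf's `sum_histPiece_le` (pieces ≤ the partial law's own-shell mass), then the envelope
  have hpush : ∀ K t, |t| ≤ l₀ → ∀ s ∈ C K,
      ∑ τ ∈ T K, histPiece (ν K (a K) t τ) (small K τ) (u K) (v K) (fun s => a K (lvl K s)) s ≤
        M₁ * (law K (a K) s {x | a K (lvl K s) * (1 - ρ (lvl K s)) ≤ u K s x ∧ u K s x < a K (lvl K s)}).toReal := by
    intro K t ht s hs
    have h1 := sum_histPiece_le (T K) (ν K (a K) t) (small K) (hu K) (uB := v K) (ϑ := fun s => a K (lvl K s))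
      (ρ := ρ (lvl K s)) (s := s) fun τ hτ hsm => hclose K t ht τ hτ s hsm
    rw [one_mul] at h1
    exact h1.trans (toReal_le_of_le_smul hM₁ (henv K t ht s hs) _)
  exact levelLedger_of_goodAssignment (X := fun K _ => Ω K) (ν := law) (w := u) (lvl := lvl) (ρ := ρ) (l₀ := l₀) (T := T)
    (S := C) (A := fun K b t τ => histWeight (ν K b t τ) (small K τ) (u K) (fun s => b (lvl K s)))
    (sh := fun K b t τ => histShell (ν K b t τ) (small K τ) (u K) (v K) (fun s => b (lvl K s)))
    (piece := fun K b t s τ => histPiece (ν K b t τ) (small K τ) (u K) (v K) (fun s => b (lvl K s)) s)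
    (M₁ := M₁) (M₂ := M₂) (D' := D') a hgood hD' hρ0 hM₁ hM₂
    (fun K t _ τ _ => histShell_nonneg _ _ _ _ _)
    (fun K t _ τ _ => histShell_le_histWeight _ _ (hu K) _ _)
    (fun K t _ τ hτ => histShell_le_sum_piece _ (hsmall K τ hτ) (hu K) (hv K) _)
    hpush hmass

end OneRun

/-! ## §3 TWO RUNS: ONE selected admissible assignment per comparison, BOTH history ledgers at it -/

section TwoRuns

variable {Ω : ℕ → Type*} [∀ K, MeasurableSpace (Ω K)] {σ ι : Type*} [DecidableEq σ]
  {T : ℕ → Finset ι} {C : ℕ → Finset σ} {small : ℕ → ι → Finset σ} {lvl : ℕ → σ → ℕ}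
  {νA νB : ∀ K : ℕ, (ℕ → ℝ) → ℝ → ι → Measure (Ω K)} [∀ K a t τ, IsFiniteMeasure (νA K a t τ)] [∀ K a t τ, IsFiniteMeasure (νB K a t τ)]
  {lawA lawB : ∀ K : ℕ, (ℕ → ℝ) → σ → Measure (Ω K)} [∀ K a s, IsFiniteMeasure (lawA K a s)] [∀ K a s, IsFiniteMeasure (lawB K a s)]
  {uA uB : ∀ K : ℕ, σ → Ω K → ℝ} {θ κ ρ Δ : ℕ → ℝ} {l₀ M₁ M₂ νbar : ℝ}

/-- **BOTH RUNS' HISTORY LEDGERS AT THE SAME SELECTED THRESHOLDS.**  DATA (comparison `K` of the two runs of the spine, on the common spaces `Ω K`): common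
histories `T K`, live slots `C K ⊇ small K τ` with levels `lvl K s ≤ K` and at most `ν̄` slots per level (N20's window∕count); each run's THRESHOLD-PARAMETRIC
finite history weights `ν^X K a t τ` over the admissible box `a j ∈ [(1 − κ_j)θ_j, θ_j]` (NODE O's term object — TYPE only) and `t`-free measurable tested
variables `u^X K s`; per run and slot an OLDER-MEASURABLE finite envelope law `law^X K a s` (`hdep`: depends on `a i`, `i < lvl K s` only — the parent law); widths
`0 ≤ ρ_j < 1` and closeness radii `Δ_j ≤ ρ_j(1 − κ_j)θ_j` (N16 BY LEVEL).  HYPOTHESES at EVERY admissible assignment and every `|t| ≤ l₀`: a.e. closeness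
`|u^A_s − u^B_s| ≤ Δ_{lvl s}` under each run's weights of the histories in which `s` is live-small; the envelopes `partialLaw^X_s ≤ M₁ • law^X K a s`; the mass
controls `M₂·law^X(univ) ≤ Σ_τ A^X_τ`.  CONCLUSION: ONE assignment `a K` per comparison, admissible at every level, at which BOTH runs' `LevelLedger`s hold for
the history letters (`histWeight ∕ histShell ∕ histPiece` at thresholds `a K (lvl K s)`) with `D j = (M₁∕M₂)·2ν̄∕((1 − ρ_j)κ_j)` — module 18b's
`exists_goodAssignment` on the joint slot family `C K × {A, B}` (index type `σ × Bool`), then §2 per run.  Every (R) binder, the piece pushes and (M1) are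
PROVED; displayed: envelopes + `hdep`, mass controls, closeness, window∕count, the admissible box. [folklore] -/
theorem levelLedgers_histories_of_selectedThresholds
    (huA : ∀ K s, Measurable (uA K s)) (huB : ∀ K s, Measurable (uB K s))
    (hsmall : ∀ K, ∀ τ ∈ T K, small K τ ⊆ C K)
    (hθ : ∀ j, 0 < θ j) (hκ : ∀ j, 0 < κ j ∧ κ j ≤ 1) (hρ : ∀ j, 0 ≤ ρ j ∧ ρ j < 1)
    (hcount : ∀ K m, ((((C K).filter fun s => lvl K s = m).card : ℕ) : ℝ) ≤ νbar)
    (hle : ∀ K, ∀ s ∈ C K, lvl K s ≤ K) (hM₁ : 0 ≤ M₁) (hM₂ : 0 < M₂)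
    (hdepA : ∀ (K : ℕ) (s : σ) (a b : ℕ → ℝ), (∀ i, i < lvl K s → a i = b i) → lawA K a s = lawA K b s)
    (hdepB : ∀ (K : ℕ) (s : σ) (a b : ℕ → ℝ), (∀ i, i < lvl K s → a i = b i) → lawB K a s = lawB K b s)
    (hΔ : ∀ j, Δ j ≤ ρ j * ((1 - κ j) * θ j))
    (hcloseA : ∀ (K : ℕ) (a : ℕ → ℝ), (∀ j, a j ∈ Icc ((1 - κ j) * θ j) (θ j)) → ∀ t, |t| ≤ l₀ → ∀ τ ∈ T K, ∀ s ∈ small K τ,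
      ∀ᵐ ω ∂(νA K a t τ), |uA K s ω - uB K s ω| ≤ Δ (lvl K s))
    (hcloseB : ∀ (K : ℕ) (a : ℕ → ℝ), (∀ j, a j ∈ Icc ((1 - κ j) * θ j) (θ j)) → ∀ t, |t| ≤ l₀ → ∀ τ ∈ T K, ∀ s ∈ small K τ,
      ∀ᵐ ω ∂(νB K a t τ), |uB K s ω - uA K s ω| ≤ Δ (lvl K s))
    (henvA : ∀ (K : ℕ) (a : ℕ → ℝ), (∀ j, a j ∈ Icc ((1 - κ j) * θ j) (θ j)) → ∀ t, |t| ≤ l₀ → ∀ s ∈ C K,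
      partialLaw (T K) (νA K a t) (small K) (uA K) (fun s => a (lvl K s)) s ≤ ENNReal.ofReal M₁ • lawA K a s)
    (henvB : ∀ (K : ℕ) (a : ℕ → ℝ), (∀ j, a j ∈ Icc ((1 - κ j) * θ j) (θ j)) → ∀ t, |t| ≤ l₀ → ∀ s ∈ C K,
      partialLaw (T K) (νB K a t) (small K) (uB K) (fun s => a (lvl K s)) s ≤ ENNReal.ofReal M₁ • lawB K a s)
    (hmassA : ∀ (K : ℕ) (a : ℕ → ℝ), (∀ j, a j ∈ Icc ((1 - κ j) * θ j) (θ j)) → ∀ t, |t| ≤ l₀ → ∀ s ∈ C K,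
      M₂ * (lawA K a s univ).toReal ≤ ∑ τ ∈ T K, histWeight (νA K a t τ) (small K τ) (uA K) (fun s => a (lvl K s)))
    (hmassB : ∀ (K : ℕ) (a : ℕ → ℝ), (∀ j, a j ∈ Icc ((1 - κ j) * θ j) (θ j)) → ∀ t, |t| ≤ l₀ → ∀ s ∈ C K,
      M₂ * (lawB K a s univ).toReal ≤ ∑ τ ∈ T K, histWeight (νB K a t τ) (small K τ) (uB K) (fun s => a (lvl K s))) :
    ∃ a : ℕ → ℕ → ℝ, (∀ K j, a K j ∈ Icc ((1 - κ j) * θ j) (θ j)) ∧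
      LevelLedger l₀ T (fun K t τ => histWeight (νA K (a K) t τ) (small K τ) (uA K) (fun s => a K (lvl K s)))
        (fun K t τ => histShell (νA K (a K) t τ) (small K τ) (uA K) (uB K) (fun s => a K (lvl K s))) C
        (fun K t s τ => histPiece (νA K (a K) t τ) (small K τ) (uA K) (uB K) (fun s => a K (lvl K s)) s) lvl
        (fun j => M₁ / M₂ * (2 * νbar / ((1 - ρ j) * κ j))) ρ ∧
      LevelLedger l₀ T (fun K t τ => histWeight (νB K (a K) t τ) (small K τ) (uB K) (fun s => a K (lvl K s)))
        (fun K t τ => histShell (νB K (a K) t τ) (small K τ) (uB K) (uA K) (fun s => a K (lvl K s))) C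
        (fun K t s τ => histPiece (νB K (a K) t τ) (small K τ) (uB K) (uA K) (fun s => a K (lvl K s)) s) lvl
        (fun j => M₁ / M₂ * (2 * νbar / ((1 - ρ j) * κ j))) ρ := by
  classical
  -- the joint slot family of both runs on `σ × Bool`: `(s, true)` reads `(lawA, uA)`, `(s, false)` reads `(lawB, uB)`
  let SA' : ℕ → Finset (σ × Bool) := fun K => (C K).image fun s => (s, true)
  let SB' : ℕ → Finset (σ × Bool) := fun K => (C K).image fun s => (s, false)
  let lvl' : ℕ → σ × Bool → ℕ := fun K s' => lvl K s'.1
  let ν' : ∀ K : ℕ, (ℕ → ℝ) → ∀ s' : σ × Bool, Measure (Ω K) := fun K a s' => bif s'.2 then lawA K a s'.1 else lawB K a s'.1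
  let w' : ∀ (K : ℕ) (s' : σ × Bool), Ω K → ℝ := fun K s' => bif s'.2 then uA K s'.1 else uB K s'.1
  have hfin' : ∀ K a s', IsFiniteMeasure (ν' K a s') := fun K a s' => by
    rcases s' with ⟨s, _ | _⟩
    · show IsFiniteMeasure (lawB K a s); infer_instance
    · show IsFiniteMeasure (lawA K a s); infer_instance
  have hw' : ∀ K s', Measurable (w' K s') := fun K s' => by
    rcases s' with ⟨s, _ | _⟩
    · exact huB K s
    · exact huA K s
  have hdep' : ∀ (K : ℕ) (s' : σ × Bool) (a b : ℕ → ℝ), (∀ i, i < lvl' K s' → a i = b i) → ν' K a s' = ν' K b s' :=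
    fun K s' a b hab => by
    rcases s' with ⟨s, _ | _⟩
    · exact hdepB K s a b hab
    · exact hdepA K s a b hab
  have hcnt : ∀ (K m : ℕ) (b : Bool),
      (((C K).image fun s => (s, b)).filter fun s' => lvl' K s' = m).card = ((C K).filter fun s => lvl K s = m).card := by
    intro K m b
    rw [Finset.filter_image, Finset.card_image_of_injective _ fun s₁ s₂ h => congrArg Prod.fst h]
  have hcard' : ∀ K m, ((((SA' K ∪ SB' K).filter fun s' => lvl' K s' = m).card : ℕ) : ℝ) ≤ 2 * νbar := by
    intro K m
    have h := hcount K m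
    have hc : ((SA' K ∪ SB' K).filter fun s' => lvl' K s' = m).card ≤ 2 * ((C K).filter fun s => lvl K s = m).card := by
      rw [Finset.filter_union]
      refine (Finset.card_union_le _ _).trans ?_
      show (((C K).image fun s => (s, true)).filter fun s' => lvl' K s' = m).card +
          (((C K).image fun s => (s, false)).filter fun s' => lvl' K s' = m).card ≤ _
      rw [hcnt K m true, hcnt K m false]
      omega
    calc ((((SA' K ∪ SB' K).filter fun s' => lvl' K s' = m).card : ℕ) : ℝ)
        ≤ ((2 * ((C K).filter fun s => lvl K s = m).card : ℕ) : ℝ) := by exact_mod_cast hc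
      _ = 2 * ((((C K).filter fun s => lvl K s = m).card : ℕ) : ℝ) := by push_cast; ring
      _ ≤ 2 * νbar := by linarith
  -- 18b's selection on the joint family
  have hsel := fun K => exists_goodAssignment (X := fun K _ => Ω K) (SA := SA') (SB := SB') (lvl := lvl') (ν := ν') (w := w')
    (θ := θ) (κ := κ) (ρ := ρ) (Fbar := 2 * νbar) hw' hθ hκ hρ hdep' hcard' K
  choose a hadm hgood using hsel
  have hmemA : ∀ K, ∀ s ∈ C K, (s, true) ∈ SA' K ∪ SB' K := fun K s hs =>
    Finset.mem_union_left _ (Finset.mem_image_of_mem _ hs)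
  have hmemB : ∀ K, ∀ s ∈ C K, (s, false) ∈ SA' K ∪ SB' K := fun K s hs =>
    Finset.mem_union_right _ (Finset.mem_image_of_mem _ hs)
  have hgoodA : ∀ K, ∀ s ∈ C K, SlotAntiConcentration (lawA K (a K) s) (uA K s) (a K (lvl K s)) (ρ (lvl K s))
      (2 * νbar / ((1 - ρ (lvl K s)) * κ (lvl K s))) := fun K s hs => hgood K (s, true) (hmemA K s hs) (hle K s hs)
  have hgoodB : ∀ K, ∀ s ∈ C K, SlotAntiConcentration (lawB K (a K) s) (uB K s) (a K (lvl K s)) (ρ (lvl K s))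
      (2 * νbar / ((1 - ρ (lvl K s)) * κ (lvl K s))) := fun K s hs => hgood K (s, false) (hmemB K s hs) (hle K s hs)
  -- constants and the closeness radius at the selected thresholds
  have hνbar : 0 ≤ νbar := (Nat.cast_nonneg _).trans (hcount 0 0)
  have hD' : ∀ j, 0 ≤ 2 * νbar / ((1 - ρ j) * κ j) := fun j => by
    have h1 : 0 < 1 - ρ j := by linarith [(hρ j).2]
    have h2 := (hκ j).1
    positivity
  have hrad : ∀ K j, Δ j ≤ ρ j * a K j := fun K j =>
    (hΔ j).trans (mul_le_mul_of_nonneg_left (hadm K j).1 (hρ j).1)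
  refine ⟨a, hadm, ?_, ?_⟩
  · exact levelLedger_histories_of_goodAssignment (ν := νA) (law := lawA) (u := uA) (v := uB) a huA huB hsmall hgoodA hD'
      (fun j => (hρ j).1) hM₁ hM₂
      (fun K t ht τ hτ s hs => (hcloseA K (a K) (hadm K) t ht τ hτ s hs).mono fun ω hω => hω.trans (hrad K _))
      (fun K t ht s hs => henvA K (a K) (hadm K) t ht s hs) (fun K t ht s hs => hmassA K (a K) (hadm K) t ht s hs)
  · exact levelLedger_histories_of_goodAssignment (ν := νB) (law := lawB) (u := uB) (v := uA) a huB huA hsmall hgoodB hD'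
      (fun j => (hρ j).1) hM₁ hM₂
      (fun K t ht τ hτ s hs => (hcloseB K (a K) (hadm K) t ht τ hτ s hs).mono fun ω hω => hω.trans (hrad K _))
      (fun K t ht s hs => henvB K (a K) (hadm K) t ht s hs) (fun K t ht s hs => hmassB K (a K) (hadm K) t ht s hs)

/-! ## §4 Road I's `ShellWeightBound` for the two history families at the selected thresholds -/

/-- **N21's ROAD I ON HISTORY-INDEXED TERM FAMILIES AT SELECTED THRESHOLDS.**  The data of `levelLedgers_histories_of_selectedThresholds` with N20's live
window `LiveWindow C lvl N₁ ν̄` (in place of `hle`∕`hcount`) + `0 < κ_min ≤ κ_j` + `ρ_j ≤ ½` + N16's rate `0 < ϑ < 1`, `ρ_j ≤ c₁ϑ^j` ⟹ for SOME assignment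
`a K` per comparison, admissible at every level:
`ShellWeightBound l₀ T A B shA shB (K ↦ C·ϑ^K)`, `C = 2((N₁+1)·ν̄·(M₁∕M₂·(4ν̄∕κ_min))·c₁·ϑ^{−N₁})`, for the two runs' history letters at `a` — n21-a's
`n21_knit_levels_geometric` (p408928) on §3's two ledgers.  All (R) binders, both piece pushes and (M1) PROVED; displayed as in §3 + window + rate.
[folklore] -/
theorem shellWeightBound_histories_of_selectedThresholds {N₁ : ℕ} {κmin c₁ ϑ : ℝ}
    (huA : ∀ K s, Measurable (uA K s)) (huB : ∀ K s, Measurable (uB K s))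
    (hsmall : ∀ K, ∀ τ ∈ T K, small K τ ⊆ C K)
    (hθ : ∀ j, 0 < θ j) (hκ : ∀ j, 0 < κ j ∧ κ j ≤ 1) (hρ : ∀ j, 0 ≤ ρ j ∧ ρ j < 1)
    (hwin : LiveWindow C lvl N₁ νbar) (hM₁ : 0 ≤ M₁) (hM₂ : 0 < M₂)
    (hdepA : ∀ (K : ℕ) (s : σ) (a b : ℕ → ℝ), (∀ i, i < lvl K s → a i = b i) → lawA K a s = lawA K b s)
    (hdepB : ∀ (K : ℕ) (s : σ) (a b : ℕ → ℝ), (∀ i, i < lvl K s → a i = b i) → lawB K a s = lawB K b s)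
    (hΔ : ∀ j, Δ j ≤ ρ j * ((1 - κ j) * θ j))
    (hcloseA : ∀ (K : ℕ) (a : ℕ → ℝ), (∀ j, a j ∈ Icc ((1 - κ j) * θ j) (θ j)) → ∀ t, |t| ≤ l₀ → ∀ τ ∈ T K, ∀ s ∈ small K τ,
      ∀ᵐ ω ∂(νA K a t τ), |uA K s ω - uB K s ω| ≤ Δ (lvl K s))
    (hcloseB : ∀ (K : ℕ) (a : ℕ → ℝ), (∀ j, a j ∈ Icc ((1 - κ j) * θ j) (θ j)) → ∀ t, |t| ≤ l₀ → ∀ τ ∈ T K, ∀ s ∈ small K τ,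
      ∀ᵐ ω ∂(νB K a t τ), |uB K s ω - uA K s ω| ≤ Δ (lvl K s))
    (henvA : ∀ (K : ℕ) (a : ℕ → ℝ), (∀ j, a j ∈ Icc ((1 - κ j) * θ j) (θ j)) → ∀ t, |t| ≤ l₀ → ∀ s ∈ C K,
      partialLaw (T K) (νA K a t) (small K) (uA K) (fun s => a (lvl K s)) s ≤ ENNReal.ofReal M₁ • lawA K a s)
    (henvB : ∀ (K : ℕ) (a : ℕ → ℝ), (∀ j, a j ∈ Icc ((1 - κ j) * θ j) (θ j)) → ∀ t, |t| ≤ l₀ → ∀ s ∈ C K,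
      partialLaw (T K) (νB K a t) (small K) (uB K) (fun s => a (lvl K s)) s ≤ ENNReal.ofReal M₁ • lawB K a s)
    (hmassA : ∀ (K : ℕ) (a : ℕ → ℝ), (∀ j, a j ∈ Icc ((1 - κ j) * θ j) (θ j)) → ∀ t, |t| ≤ l₀ → ∀ s ∈ C K,
      M₂ * (lawA K a s univ).toReal ≤ ∑ τ ∈ T K, histWeight (νA K a t τ) (small K τ) (uA K) (fun s => a (lvl K s)))
    (hmassB : ∀ (K : ℕ) (a : ℕ → ℝ), (∀ j, a j ∈ Icc ((1 - κ j) * θ j) (θ j)) → ∀ t, |t| ≤ l₀ → ∀ s ∈ C K,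
      M₂ * (lawB K a s univ).toReal ≤ ∑ τ ∈ T K, histWeight (νB K a t τ) (small K τ) (uB K) (fun s => a (lvl K s)))
    (hκmin : 0 < κmin) (hκminle : ∀ j, κmin ≤ κ j) (hρhalf : ∀ j, ρ j ≤ 1 / 2)
    (hϑ0 : 0 < ϑ) (hϑ1 : ϑ < 1) (hrate : ∀ j, ρ j ≤ c₁ * ϑ ^ j) :
    ∃ a : ℕ → ℕ → ℝ, (∀ K j, a K j ∈ Icc ((1 - κ j) * θ j) (θ j)) ∧
      ShellWeightBound l₀ T (fun K t τ => histWeight (νA K (a K) t τ) (small K τ) (uA K) (fun s => a K (lvl K s)))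
        (fun K t τ => histWeight (νB K (a K) t τ) (small K τ) (uB K) (fun s => a K (lvl K s)))
        (fun K t τ => histShell (νA K (a K) t τ) (small K τ) (uA K) (uB K) (fun s => a K (lvl K s)))
        (fun K t τ => histShell (νB K (a K) t τ) (small K τ) (uB K) (uA K) (fun s => a K (lvl K s)))
        fun K => (2 * ((N₁ + 1) * νbar * (M₁ / M₂ * (2 * (2 * νbar) / κmin)) * c₁ * ϑ⁻¹ ^ N₁)) * ϑ ^ K := by
  obtain ⟨a, hadm, hLA, hLB⟩ := levelLedgers_histories_of_selectedThresholds huA huB hsmall hθ hκ hρ hwin.count hwin.le_top hM₁ hM₂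
    hdepA hdepB hΔ hcloseA hcloseB henvA henvB hmassA hmassB
  have hF : 0 ≤ 2 * νbar := by have := hwin.νbar_nonneg; positivity
  have hD : ∀ j, M₁ / M₂ * (2 * νbar / ((1 - ρ j) * κ j)) ≤ M₁ / M₂ * (2 * (2 * νbar) / κmin) := fun j =>
    mul_le_mul_of_nonneg_left (levelConst_le hF (hρhalf j) hκmin (hκminle j)) (div_nonneg hM₁ hM₂.le)
  exact ⟨a, hadm, n21_knit_levels_geometric hLA hLB hwin hwin hD hD hϑ0 hϑ1 hrate hrate⟩

end TwoRuns

end Summit.QuantumFields.YangMills.Theorems.N21SelectedThresholdsHistories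

end
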